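import Mathlib.LinearAlgebra.Matrix.Rank
import Mathlib.LinearAlgebra.Matrix.ToLin
import Mathlib.LinearAlgebra.Matrix.Basis
import Mathlib.LinearAlgebra.Matrix.NonsingularInverse
import Mathlib.LinearAlgebra.FiniteDimensional.Basic
import Mathlib.LinearAlgebra.FreeModule.PID
import Mathlib.LinearAlgebra.Projection
import Mathlib.LinearAlgebra.Basis.SMul
import Mathlib.Data.Int.Order.Units
import HarnessLib

/-!
# Linear algebra for Waldschmidt 1981, §6 c) (Théorème 1.1 ⟹ Théorème 2.1)

Topic `Literature/NumberTheory/Transcendental`; companion of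
`SixExponentialsSeveralVariables.lean` (the named facts `Waldschmidt1981.thm_1_1`,
`Waldschmidt1981.thm_2_1` of [Waldschmidt1981]) and first half of the proof, in the tree, of the
printed deduction of Théorème 2.1 (matrices of logarithms of algebraic numbers) from Théorème 1.1
(subgroups `X, Y ⊂ ℂⁿ`), [Waldschmidt1981, §6 c), p. 111]:

> "Comme la matrice `M` est de rang `r`, il existe deux applications linéaires surjectives
> `ξ : ℂ^d → ℂ^r` et `η : ℂ^ℓ → ℂ^r` telles que `ᵗξ ∘ η` soit l'application linéaire associée à
> `M` … `⟨xᵢ, yⱼ⟩ = log α_{i,j}` … Grâce au théorème 1.1 on peut écrire `X = ℤx'₁ + … + ℤx'_d`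
> et `Y = ℤy'₁ + … + ℤy'_ℓ` avec `⟨x'ᵢ, y'ⱼ⟩ = 0 (1 ≤ i ≤ d₁, ℓ₂ < j ≤ ℓ)` … On définit
> `P ∈ SL_d(ℤ)` et `Q ∈ SL_ℓ(ℤ)` par `(x'ᵢ) = P(xᵢ)`, `(y'ⱼ) = (yⱼ)Q`. Alors
> `PMQ = (⟨x'ᵢ, y'ⱼ⟩)`. Comme `η` est surjective, `Y` contient une base de `ℂ^r` sur `ℂ`, donc la
> matrice `M₁ = (⟨x'ᵢ, y'ⱼ⟩)_{1 ≤ i ≤ d₁, 1 ≤ j ≤ ℓ₁}` a un rang égal à `n₁`."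

This file supplies the three pieces of pure linear algebra this paragraph uses, in the
generality in which they hold (any field `K`, any abelian group `E`), all PROVED:

* `exists_eq_dotProduct_span_eq_top` — rank factorisation `M = (⟨xᵢ, yⱼ⟩)` through `K^r`,
  `r = rank M`, with the `yⱼ` spanning `K^r` (the surjectivity of `η`);
* `rank_submatrix_eq_finrank_span` — if `N = (⟨eᵢ, fⱼ⟩)` with the `fⱼ` spanning and
  `⟨eᵢ, fⱼ⟩ = 0` for `i < d₁ ≤ j`-block indices `j ≥ ℓ₁`, the upper-left `d₁ × ℓ₁` block has rank
  `dim span {eᵢ ; i < d₁}` ("`M₁` a un rang égal à `n₁`");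
* `exists_adapted_basis` — for `ℤ`-linearly independent `v₁, …, v_d` and an internal direct sum
  `∑ ℤvᵢ = A ⊕ B`, a unimodular (`det = 1`) integer change of basis to a basis whose first
  `rank A` vectors generate `A` and whose remaining vectors lie in `B` (the matrices `P`, `Q`;
  subgroups of finitely generated free abelian groups are free, `Submodule.basisOfPid`, and one
  sign is adjusted to land in `SL` rather than `GL`).

The deduction `Waldschmidt1981.thm_2_1_of_thm_1_1` itself is in
`SixExponentialsSeveralVariablesProofs.lean`.

## References

* [Waldschmidt1981] M. Waldschmidt, *Transcendance et exponentielles en plusieurs variables*,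
  Invent. Math. 63 (1981) 97–127, §2 (p. 100: rank `≤ n` ⟺ `u_{i,j} = ⟨xᵢ, yⱼ⟩`, `xᵢ, yⱼ ∈ Kⁿ`)
  and §6 c) (p. 111).
-/

noncomputable section

open Matrix Module

namespace Literature.NumberTheory.Transcendental.Waldschmidt1981

/-- **Rank factorisation through the row space** (§2 of the source, (i) ⟹ (ii): "le rang de `M`
est inférieur ou égal à `n`" ⟹ "il existe `x₁, …, x_d, y₁, …, y_ℓ` dans `Kⁿ` tels que
`u_{i,j} = ⟨xᵢ, yⱼ⟩`"), in the sharp form used in §6 c): a `d × ℓ` matrix of rank `r` over a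
field is `(⟨xᵢ, yⱼ⟩)` with `xᵢ, yⱼ ∈ K^r` and the `yⱼ` spanning `K^r` ("comme `η` est
surjective, `Y` contient une base de `ℂ^r`"). Construction: `xᵢ` = coordinates of the `i`-th
row in a basis `b` of the row space, `yⱼ = (bₖ(j))ₖ`. [cite: Waldschmidt1981, §2 (p. 100) and §6 c) (p. 111)] -/
theorem exists_eq_dotProduct_span_eq_top {K : Type*} [Field K] {d l : ℕ}
    (M : Matrix (Fin d) (Fin l) K) :
    ∃ (x : Fin d → Fin M.rank → K) (y : Fin l → Fin M.rank → K),
      (∀ i j, M i j = x i ⬝ᵥ y j) ∧ Submodule.span K (Set.range y) = ⊤ := by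
  classical
  set V : Submodule K (Fin l → K) := Submodule.span K (Set.range M.row) with hV
  have hVr : Module.finrank K V = M.rank := (M.rank_eq_finrank_span_row).symm
  let b : Basis (Fin M.rank) K V := Module.finBasisOfFinrankEq K V hVr
  have hrow : ∀ i, M.row i ∈ V := fun i => Submodule.subset_span ⟨i, rfl⟩
  refine ⟨fun i k => b.repr ⟨M.row i, hrow i⟩ k, fun j k => (b k : Fin l → K) j, ?_, ?_⟩
  · intro i j
    have h := congrArg (fun w : V => (w : Fin l → K) j) (b.sum_repr ⟨M.row i, hrow i⟩)
    simp only [Submodule.coe_sum, Submodule.coe_smul, Finset.sum_apply, Pi.smul_apply,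
      smul_eq_mul] at h
    simpa [dotProduct] using h.symm
  · -- the `yⱼ` are the columns of the matrix `B` whose rows are the basis vectors `bₖ`
    let B : Matrix (Fin M.rank) (Fin l) K := Matrix.of fun k j => (b k : Fin l → K) j
    have hli : LinearIndependent K B.row := by
      have h := b.linearIndependent.map' V.subtype (Submodule.ker_subtype V)
      exact h
    have hB : B.rank = M.rank := by simpa using hli.rank_matrix
    have hcol : B.col = fun j k => (b k : Fin l → K) j := rfl
    apply Submodule.eq_top_of_finrank_eq
    rw [Module.finrank_fin_fun, ← hcol, ← B.rank_eq_finrank_span_cols, hB]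

/-- Orthogonality to a spanning family forces vanishing: if the `f j` span `K^r` and
`u ⬝ᵥ f j = 0` for all `j` then `u = 0`. [folklore] -/
theorem eq_zero_of_dotProduct_eq_zero {K : Type*} [Field K] {r : ℕ} {ι : Type*}
    {f : ι → Fin r → K} (hf : Submodule.span K (Set.range f) = ⊤) {u : Fin r → K}
    (hu : ∀ j, u ⬝ᵥ f j = 0) : u = 0 := by
  have hall : ∀ v ∈ Submodule.span K (Set.range f), u ⬝ᵥ v = 0 := by
    intro v hv
    induction hv using Submodule.span_induction with
    | mem w hw => obtain ⟨j, rfl⟩ := hw; exact hu j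
    | zero => simp
    | add v w _ _ hv hw => rw [dotProduct_add, hv, hw, add_zero]
    | smul c v _ hv => rw [dotProduct_smul, hv, smul_zero]
  funext k
  have h := hall (Pi.single k 1) (by rw [hf]; exact Submodule.mem_top)
  rwa [dotProduct_single, mul_one] at h

/-- The linear map `u ↦ (u ⬝ᵥ f j)ⱼ` is injective when the `f j` span. [folklore] -/
theorem mulVecLin_injective_of_span_eq_top {K : Type*} [Field K] {r l : ℕ}
    {f : Fin l → Fin r → K} (hf : Submodule.span K (Set.range f) = ⊤) :
    Function.Injective (Matrix.of f).mulVecLin := by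
  rw [← LinearMap.ker_eq_bot, Matrix.ker_mulVecLin_eq_bot_iff]
  intro u hu
  refine eq_zero_of_dotProduct_eq_zero hf fun j => ?_
  have h := congrFun hu j
  rw [Matrix.mulVec, Pi.zero_apply] at h
  change (f j) ⬝ᵥ u = 0 at h
  rwa [dotProduct_comm] at h

/-- **Rank of the block `M₁`** (§6 c) of the source: "comme `η` est surjective, `Y` contient une
base de `ℂ^r` sur `ℂ`, donc la matrice `M₁ = (⟨x'ᵢ, y'ⱼ⟩)_{1≤i≤d₁,1≤j≤ℓ₁}` a un rang égal à
`n₁`"). If `N = (⟨eᵢ, fⱼ⟩)` with the `fⱼ` spanning `K^r` and `⟨eᵢ, fⱼ⟩ = 0` for `i < d₁`,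
`j ≥ ℓ₁`, then the upper-left `d₁ × ℓ₁` block of `N` has rank `dim_K span_K {eᵢ ; i < d₁}`.
[cite: Waldschmidt1981, §6 c) (p. 111)] -/
theorem rank_submatrix_eq_finrank_span {K : Type*} [Field K] {d l r d₁ l₁ : ℕ}
    (e : Fin d → Fin r → K) (f : Fin l → Fin r → K)
    (hf : Submodule.span K (Set.range f) = ⊤) (hd : d₁ ≤ d) (hl : l₁ ≤ l)
    (hzero : ∀ (i : Fin d) (j : Fin l), (i : ℕ) < d₁ → l₁ ≤ (j : ℕ) → e i ⬝ᵥ f j = 0) :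
    ((Matrix.of fun i j => e i ⬝ᵥ f j).submatrix (Fin.castLE hd) (Fin.castLE hl)).rank =
      Module.finrank K
        (Submodule.span K (Set.range fun i : Fin d₁ => e (Fin.castLE hd i))) := by
  classical
  set N : Matrix (Fin d) (Fin l) K := Matrix.of fun i j => e i ⬝ᵥ f j with hN
  set R : Matrix (Fin d₁) (Fin l) K := N.submatrix (Fin.castLE hd) id with hR
  set M₁ : Matrix (Fin d₁) (Fin l₁) K := N.submatrix (Fin.castLE hd) (Fin.castLE hl) with hM₁
  -- (a) `rank M₁ = rank R`: `M₁ = R S` and `R = M₁ T` for selection matrices `S`, `T`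
  let S : Matrix (Fin l) (Fin l₁) K := fun j m => if (j : ℕ) = m then 1 else 0
  let T : Matrix (Fin l₁) (Fin l) K := fun m j => if (j : ℕ) = m then 1 else 0
  have hMS : M₁ = R * S := by
    ext i m
    rw [Matrix.mul_apply, Finset.sum_eq_single (Fin.castLE hl m)]
    · simp [S, R, M₁]
    · intro j _ hj
      have : ¬ ((j : ℕ) = m) := fun h => hj (Fin.ext (by simpa using h))
      simp [S, this]
    · simp
  have hRT : R = M₁ * T := by
    ext i j
    by_cases hj : (j : ℕ) < l₁
    · rw [Matrix.mul_apply, Finset.sum_eq_single ⟨j, hj⟩]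
      · have : Fin.castLE hl ⟨j, hj⟩ = j := Fin.ext rfl
        simp [T, R, M₁, this]
      · intro m _ hm
        have : ¬ ((j : ℕ) = m) := fun h => hm (Fin.ext (by simpa using h.symm))
        simp [T, this]
      · simp
    · push Not at hj
      have h0 : R i j = 0 := by
        simp only [hR, hN, Matrix.submatrix_apply, id, Matrix.of_apply]
        exact hzero _ _ (by simp) hj
      rw [h0, Matrix.mul_apply]
      refine (Finset.sum_eq_zero fun m _ => ?_).symm
      have : ¬ ((j : ℕ) = m) := by
        intro h; exact absurd (h ▸ m.isLt) (not_lt.mpr hj)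
      simp [T, this]
  have hrank : M₁.rank = R.rank := by
    apply le_antisymm
    · rw [hMS]; exact Matrix.rank_mul_le_left _ _
    · rw [hRT]; exact Matrix.rank_mul_le_left _ _
  -- (b) `rank R = dim span {T eᵢ}` with `T = (u ↦ (u ⬝ᵥ fⱼ)ⱼ)` injective
  rw [hrank, R.rank_eq_finrank_span_row]
  let Tf := (Matrix.of f).mulVecLin
  have hTf : Function.Injective Tf := mulVecLin_injective_of_span_eq_top hf
  have hrowT : R.row = Tf ∘ fun i : Fin d₁ => e (Fin.castLE hd i) := by
    funext i
    ext j
    simp only [hR, hN, Function.comp_apply, Tf, Matrix.mulVecLin_apply, Matrix.mulVec,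
      Matrix.row, Matrix.submatrix_apply, id, Matrix.of_apply]
    exact dotProduct_comm _ _
  rw [hrowT, Set.range_comp, Submodule.span_image]
  exact (LinearEquiv.finrank_eq (Submodule.equivMapOfInjective Tf hTf _)).symm

/-- **Adapted unimodular bases** (§6 c) of the source: "Grâce au théorème 1.1 on peut écrire
`X = ℤx'₁ + … + ℤx'_d` … On définit `P ∈ SL_d(ℤ)` par `(x'ᵢ) = P (xᵢ)`"). Let `v₁, …, v_d`
(`d ≥ 1`) be `ℤ`-linearly independent in an abelian group `E`, `X = ∑ ℤvᵢ`, and `X = A ⊕ B` an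
internal direct sum of subgroups. Then there is a new basis `e₁, …, e_d` of `X`, `eᵢ = ∑ₖ Pᵢₖ vₖ`
with `P ∈ SL_d(ℤ)`, whose first `d_A = rank A` vectors lie in (and generate) `A` and whose last
`d − d_A` vectors lie in `B`. (Bases of the direct factors exist because subgroups of free abelian
groups of finite rank are free; the sign of one vector is adjusted to get `det P = 1`.)
[cite: Waldschmidt1981, §6 c) (p. 111)] -/
theorem exists_adapted_basis {E : Type*} [AddCommGroup E] {d : ℕ} (hd : 0 < d)
    {v : Fin d → E} (hv : LinearIndependent ℤ v) {A B : Submodule ℤ E}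
    (hsup : A ⊔ B = Submodule.span ℤ (Set.range v)) (hinf : A ⊓ B = ⊥) :
    ∃ (dA : ℕ) (hdA : dA ≤ d) (e : Fin d → E) (P : Matrix (Fin d) (Fin d) ℤ),
      P.det = 1 ∧ (∀ i, e i = ∑ k, P i k • v k) ∧ Module.finrank ℤ A = dA ∧
      (∀ i : Fin d, (i : ℕ) < dA → e i ∈ A) ∧ (∀ i : Fin d, dA ≤ (i : ℕ) → e i ∈ B) ∧
      A ≤ Submodule.span ℤ (Set.range fun k : Fin dA => e (Fin.castLE hdA k)) ∧
      (∀ k, v k ∈ Submodule.span ℤ (Set.range e)) := by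
  classical
  set X : Submodule ℤ E := Submodule.span ℤ (Set.range v) with hX
  let bv : Basis (Fin d) ℤ X := Basis.span hv
  have hbv : ∀ k, (bv k : E) = v k := fun k =>
    congrArg (fun z : X => (z : E)) (Basis.span_apply hv k)
  have hA : A ≤ X := hsup ▸ le_sup_left
  have hB : B ≤ X := hsup ▸ le_sup_right
  -- the direct factors, viewed inside `X`
  set A' : Submodule ℤ X := A.comap X.subtype with hA'
  set B' : Submodule ℤ X := B.comap X.subtype with hB'
  have hcompl : IsCompl A' B' := by
    constructor
    · rw [disjoint_iff, hA', hB', ← Submodule.comap_inf, hinf, Submodule.comap_bot,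
        Submodule.ker_subtype]
    · rw [codisjoint_iff, eq_top_iff]
      rintro ⟨z, hz⟩ -
      have hz' : z ∈ A ⊔ B := hsup ▸ hz
      obtain ⟨a, ha, b, hb, rfl⟩ := Submodule.mem_sup.mp hz'
      have haX : a ∈ X := hA ha
      have hbX : b ∈ X := hB hb
      have : (⟨a + b, hz⟩ : X) = ⟨a, haX⟩ + ⟨b, hbX⟩ := rfl
      rw [this]
      exact Submodule.add_mem_sup (show (⟨a, haX⟩ : X) ∈ A' from ha)
        (show (⟨b, hbX⟩ : X) ∈ B' from hb)
  -- bases of the factors and the combined basis `c` of `X`, indexed by `Fin d`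
  obtain ⟨dA, bA⟩ := Submodule.basisOfPid bv A'
  obtain ⟨dB, bB⟩ := Submodule.basisOfPid bv B'
  let c₀ : Basis (Fin dA ⊕ Fin dB) ℤ X :=
    (bA.prod bB).map (Submodule.prodEquivOfIsCompl A' B' hcompl)
  have hcard : dA + dB = d := by
    have h := Fintype.card_congr (bv.indexEquiv c₀)
    simpa using h.symm
  let σ : Fin dA ⊕ Fin dB ≃ Fin d := finSumFinEquiv.trans (finCongr hcard)
  have hσl : ∀ k : Fin dA, ((σ (Sum.inl k) : Fin d) : ℕ) = k := fun k => by simp [σ]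
  have hσr : ∀ k : Fin dB, ((σ (Sum.inr k) : Fin d) : ℕ) = dA + k := fun k => by simp [σ]
  let c : Basis (Fin d) ℤ X := c₀.reindex σ
  have hc_inl : ∀ k : Fin dA, c (σ (Sum.inl k)) = (bA k : X) := fun k => by
    simp [c, c₀, Basis.reindex_apply, Basis.map_apply, Basis.prod_apply]
  have hc_inr : ∀ k : Fin dB, c (σ (Sum.inr k)) = (bB k : X) := fun k => by
    simp [c, c₀, Basis.reindex_apply, Basis.map_apply, Basis.prod_apply]
  have hdA : dA ≤ d := by omega
  -- which indices of `Fin d` come from `A` and which from `B`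
  have hmemA : ∀ i : Fin d, (i : ℕ) < dA → ∃ k : Fin dA, i = σ (Sum.inl k) ∧ (k : ℕ) = i := by
    intro i hi
    refine ⟨⟨i, hi⟩, Fin.ext ?_, rfl⟩
    rw [hσl]
  have hmemB : ∀ i : Fin d, dA ≤ (i : ℕ) → ∃ k : Fin dB, i = σ (Sum.inr k) := by
    intro i hi
    refine ⟨⟨i - dA, by omega⟩, Fin.ext ?_⟩
    rw [hσr]
    simp only
    omega
  -- the change-of-basis matrix and its sign correction
  let P₀ : Matrix (Fin d) (Fin d) ℤ := fun i k => bv.repr (c i) k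
  have hP₀ : P₀ = (bv.toMatrix c)ᵀ := by
    ext i k; simp [P₀, Basis.toMatrix_apply]
  have hP₀unit : P₀.det = 1 ∨ P₀.det = -1 := by
    rw [← Int.isUnit_iff, hP₀, Matrix.det_transpose]
    exact Matrix.isUnit_det_of_right_inverse (Basis.toMatrix_mul_toMatrix_flip bv c)
  let ε : ℤˣ := if P₀.det = 1 then 1 else -1
  have hε : (ε : ℤ) * P₀.det = 1 := by
    rcases hP₀unit with h | h
    · simp [ε, h]
    · simp [ε, h]
  let i₀ : Fin d := ⟨0, hd⟩
  let w : Fin d → ℤˣ := fun i => if i = i₀ then ε else 1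
  have hw : ∀ i, w i * w i = 1 := fun i => Int.units_mul_self (w i)
  let c' : Basis (Fin d) ℤ X := c.unitsSMul w
  have hc' : ∀ i, c' i = w i • c i := fun i => Basis.unitsSMul_apply i
  have hcc' : ∀ i, c i = w i • c' i := fun i => by
    rw [hc', smul_smul, hw, one_smul]
  let P : Matrix (Fin d) (Fin d) ℤ := fun i k => bv.repr (c' i) k
  have hPP₀ : P = Matrix.diagonal (fun i => (w i : ℤ)) * P₀ := by
    ext i k
    simp [P, P₀, Matrix.diagonal_mul, hc', Units.smul_def]
  have hdetP : P.det = 1 := by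
    rw [hPP₀, Matrix.det_mul, Matrix.det_diagonal]
    have : (∏ i, (w i : ℤ)) = ε := by
      have h := Finset.prod_ite_eq' (Finset.univ : Finset (Fin d)) i₀ (fun _ => (ε : ℤ))
      simp only [Finset.mem_univ, if_true] at h
      rw [← h]
      refine Finset.prod_congr rfl fun i _ => ?_
      by_cases hi : i = i₀ <;> simp [w, hi]
    rw [this, hε]
  -- the new basis, as a family of `E`
  refine ⟨dA, hdA, fun i => (c' i : E), P, hdetP, ?_, ?_, ?_, ?_, ?_, ?_⟩
  · -- `e i = ∑ P i k • v k`
    intro i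
    have h := congrArg (fun z : X => (z : E)) (bv.sum_repr (c' i)).symm
    simp only [Submodule.coe_sum, Submodule.coe_smul_of_tower, hbv] at h
    exact h
  · -- `rank A = dA`
    rw [← (Submodule.comapSubtypeEquivOfLe hA).finrank_eq, ← hA',
      Module.finrank_eq_card_basis bA, Fintype.card_fin]
  · -- first `dA` vectors lie in `A`
    intro i hi
    obtain ⟨k, rfl, -⟩ := hmemA i hi
    show (c' (σ (Sum.inl k)) : E) ∈ A
    rw [hc', hc_inl, Submodule.coe_smul_of_tower, Units.smul_def]
    exact A.smul_mem _ (bA k).2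
  · -- last vectors lie in `B`
    intro i hi
    obtain ⟨k, rfl⟩ := hmemB i hi
    show (c' (σ (Sum.inr k)) : E) ∈ B
    rw [hc', hc_inr, Submodule.coe_smul_of_tower, Units.smul_def]
    exact B.smul_mem _ (bB k).2
  · -- `A` is generated by the first `dA` vectors
    intro a ha
    have haX : a ∈ X := hA ha
    set a' : A' := ⟨⟨a, haX⟩, ha⟩ with ha'
    have hsum := congrArg (fun z : A' => ((z : X) : E)) (bA.sum_repr a').symm
    have hcoe : ((a' : X) : E) = a := rfl
    rw [hcoe] at hsum
    rw [hsum]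
    simp only [Submodule.coe_sum, Submodule.coe_smul_of_tower]
    refine Submodule.sum_mem _ fun k _ => Submodule.smul_mem _ _ ?_
    have hk : ((bA k : X) : E) = (w (σ (Sum.inl k)) : ℤ) • (c' (σ (Sum.inl k)) : E) := by
      rw [← hc_inl, hcc', Submodule.coe_smul_of_tower, Units.smul_def]
    rw [hk]
    refine Submodule.smul_mem _ _ (Submodule.subset_span ⟨k, ?_⟩)
    have hidx : Fin.castLE hdA k = σ (Sum.inl k) := Fin.ext (by simp [hσl])
    show (c' (Fin.castLE hdA k) : E) = c' (σ (Sum.inl k))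
    rw [hidx]
  · -- the old generators lie in the span of the new basis
    intro k
    have h := congrArg (fun z : X => (z : E)) (c'.sum_repr (bv k)).symm
    rw [hbv] at h
    rw [h]
    simp only [Submodule.coe_sum, Submodule.coe_smul_of_tower]
    exact Submodule.sum_mem _ fun i _ =>
      Submodule.smul_mem _ _ (Submodule.subset_span ⟨i, rfl⟩)

end Literature.NumberTheory.Transcendental.Waldschmidt1981

end
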